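import Summits.ValiantsHypothesis.ValiantsHypothesis.Theorems.SymPencilSdcSuperquadraticStubBlockRankFour
import Mathlib.LinearAlgebra.Dual.Lemmas

/-!
# Route `SymPencil` — quantitative radical bound on the two-free-rows block
# (`--supports` stmt-ValiantsHypothesis-5674 `SdcSuperquadratic`; the rank side of the sizes past
# the rung `sdc(per_4) ≥ 21` of line `box_four`)

Let `V` be a linear space of `4 × 4` matrices with two prescribed zero rows (or columns),
`dim V = d ≤ 8`, and suppose that for EVERY base point `u` the `s²`-coefficient of
`s ↦ per_4 (u + s y)` (`y ∈ V`) is a sum `Σ_{k ∈ ι} c_k (Λ_k y)²` of `|ι|` weighted squares of linear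
forms.  Then `2 d ≤ |ι| + 8` (`two_mul_finrank_le_card_add_eight_of_sq_family`).

* `d = 8` recovers `SymPencilSdcSuperquadraticStubBlockRankFour.not_sum_sq_family_of_card_lt`
  (`|ι| ≥ 8`), the registered stub `stub_blockRankFour` being `|ι| = 3`;
* `d = 7` gives `|ι| ≥ 6` — the rank half of the case `(dim im b, dim ker b) = (9, 7)` of a
  symmetric affine determinantal representation of `per_4` of size `m = 21, 22` (defect
  `δ = m − 19 ≤ 3 < 6`), i.e. of the wall after the rung `21` recorded in the line card, for kernels
  inside a block; the other half (which `7`-dimensional subspaces of `Sing Z(per_4)` occur) is NOT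
  addressed here.

Proof.  `N = V ⊓ ⋂_k ker Λ_k` has `dim N ≥ d − |ι|` and translating by `N` fixes the form
(`exists_commonKernel`).  At `u = 𝟙` on the zero rows the `s²`-coefficient is
`H(y) = 2 (S_a S_b − Σ_j y_{aj} y_{bj})` (`eval_perPoly_ones01_add_smul`), whose polarisation is a
perfect pairing of the block (`2 (J − I)`, `det (J − I) = −3`), so `x₀ ↦ B(x₀, ·)` embeds `N` into
the annihilator of `V ⊕ W'` (`W'` the complementary block): `dim N ≤ 16 − (d + 8)`
(`finrank_add_finrank_le_eight_rows01`).  Rows `0, 1` first; transport by row permutations and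
transposition as in `SymPencilPerFourTwoRowsRadical`.

Honest framing: helper inequalities only; the rung `sdc(per_4) ≥ 21`, the crux `SdcSuperquadratic`
and `VP ≠ VNP` are not touched.  No definitions, no named facts. [folklore]
-/

noncomputable section

-- single-conjunct layout: Sub = Summit, duplicated namespace component intended
set_option linter.dupNamespace false

namespace Summit.ValiantsHypothesis.ValiantsHypothesis.Theorems.SymPencilPerFourCoordinateRadical

open MvPolynomial Module
open Literature.Computability.AlgebraicComplexity
open Summit.ValiantsHypothesis.ValiantsHypothesis.Theorems.SymPencilPerFourBlocks
open Summit.ValiantsHypothesis.ValiantsHypothesis.Theorems.SymPencilPerFourTwoRowsRadical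

variable {K : Type*} [Field K]

/-- **Common kernel of `|ι|` linear forms inside `V`.**  There is a subspace `N ≤ V` of dimension
`≥ dim V − |ι|` on which every `Λ_k` vanishes. [folklore] -/
theorem exists_commonKernel {M ι : Type*} [AddCommGroup M] [Module K M] [Fintype ι]
    (V : Submodule K M) [FiniteDimensional K V] (Λ : ι → (M →ₗ[K] K)) :
    ∃ N : Submodule K M, N ≤ V ∧ finrank K V ≤ finrank K N + Fintype.card ι ∧
      ∀ x ∈ N, ∀ k, Λ k x = 0 := by
  let L : ↥V →ₗ[K] (ι → K) := (LinearMap.pi Λ).comp V.subtype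
  refine ⟨(LinearMap.ker L).map V.subtype, Submodule.map_subtype_le _ _, ?_, ?_⟩
  · have h1 := L.finrank_range_add_finrank_ker
    have h2 : finrank K (LinearMap.range L) ≤ Fintype.card ι :=
      (LinearMap.range L).finrank_le.trans (finrank_fintype_fun_eq_card K).le
    rw [Submodule.finrank_map_subtype_eq]
    omega
  · rintro _ ⟨w, hw, rfl⟩ k
    have h := congr_fun (LinearMap.mem_ker.1 hw) k
    simpa [L] using h

/-- The space of `4 × 4` matrices with the two rows `a ≠ b` zero has dimension `8`. [folklore] -/
theorem finrank_rowsZero (a b : Fin 4) (hab : a ≠ b) :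
    finrank K ↥(LinearMap.ker (LinearMap.funLeft K K fun j : Fin 4 => (a, j)) ⊓
      LinearMap.ker (LinearMap.funLeft K K fun j : Fin 4 => (b, j))) = 8 := by
  -- adapted from `SymPencilPerFourTwoRowsRadical.mem_of_rows01` (rank–nullity twice)
  let ρ : Fin 4 → (Fin 4 × Fin 4 → K) →ₗ[K] (Fin 4 → K) :=
    fun r => LinearMap.funLeft K K fun j => (r, j)
  have hρ : ∀ r x j, ρ r x j = x (r, j) := fun _ _ _ => rfl
  have hlift : ∀ (r : Fin 4) (v : Fin 4 → K),
      ρ r (fun p : Fin 4 × Fin 4 => if p.1 = r then v p.2 else 0) = v := fun r v => by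
    funext j; simp [hρ]
  have htop : (⊤ : Submodule K (Fin 4 × Fin 4 → K)).map (ρ a) = ⊤ := by
    rw [eq_top_iff]
    rintro v -
    exact ⟨_, Submodule.mem_top, hlift a v⟩
  have hkera : finrank K ↥(LinearMap.ker (ρ a)) = 12 := by
    have h := AlperBogartVelasco.finrank_eq_finrank_map_add_finrank_inf_ker
      (⊤ : Submodule K (Fin 4 × Fin 4 → K)) (ρ a)
    rw [htop, finrank_top, finrank_top, top_inf_eq, finrank_fintype_fun_eq_card,
      finrank_fintype_fun_eq_card, Fintype.card_prod, Fintype.card_fin] at h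
    omega
  have hmapb : (LinearMap.ker (ρ a)).map (ρ b) = ⊤ := by
    rw [eq_top_iff]
    rintro v -
    refine ⟨fun p : Fin 4 × Fin 4 => if p.1 = b then v p.2 else 0, ?_, hlift b v⟩
    rw [SetLike.mem_coe, LinearMap.mem_ker]
    funext j
    simp [hρ, hab]
  have h := AlperBogartVelasco.finrank_eq_finrank_map_add_finrank_inf_ker
    (LinearMap.ker (ρ a)) (ρ b)
  rw [hmapb, finrank_top, hkera, finrank_fintype_fun_eq_card, Fintype.card_fin] at h
  change 12 = 4 + finrank K ↥(LinearMap.ker (ρ a) ⊓ LinearMap.ker (ρ b)) at h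
  show finrank K ↥(LinearMap.ker (ρ a) ⊓ LinearMap.ker (ρ b)) = 8
  omega

set_option maxHeartbeats 400000 in
/-- **Non-degeneracy count in canonical position.**  `V` = a space of matrices with rows `0, 1`
zero, `N ≤ V`, and translation by `N` leaves the form
`H(y) = 2 (S₂ S₃ − Σ_j y_{2j} y_{3j})` (the `s²`-coefficient of `per_4 (𝟙_{rows 0,1} + s y)`)
unchanged on `V`.  Then `dim N + dim V ≤ 8`: the polarisation of `H` embeds `N` into the
annihilator of `V ⊕ {rows 2, 3 zero}`. [folklore] -/
theorem finrank_add_finrank_le_eight_rows01 [CharZero K] (V N : Submodule K (Fin 4 × Fin 4 → K))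
    (hV : ∀ x ∈ V, ∀ j, x (0, j) = 0 ∧ x (1, j) = 0) (hNV : N ≤ V)
    (hrad : ∀ x₀ ∈ N, ∀ y ∈ V,
      2 * (((x₀ + y) (2, 0) + (x₀ + y) (2, 1) + (x₀ + y) (2, 2) + (x₀ + y) (2, 3)) *
            ((x₀ + y) (3, 0) + (x₀ + y) (3, 1) + (x₀ + y) (3, 2) + (x₀ + y) (3, 3)) -
          ((x₀ + y) (2, 0) * (x₀ + y) (3, 0) + (x₀ + y) (2, 1) * (x₀ + y) (3, 1) +
            (x₀ + y) (2, 2) * (x₀ + y) (3, 2) + (x₀ + y) (2, 3) * (x₀ + y) (3, 3))) =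
      2 * ((y (2, 0) + y (2, 1) + y (2, 2) + y (2, 3)) * (y (3, 0) + y (3, 1) + y (3, 2) + y (3, 3)) -
          (y (2, 0) * y (3, 0) + y (2, 1) * y (3, 1) + y (2, 2) * y (3, 2) + y (2, 3) * y (3, 3)))) :
    finrank K N + finrank K V ≤ 8 := by
  classical
  -- the polarisation `B` of `H`, as a linear map `β : E → Dual E`
  let B : (Fin 4 × Fin 4 → K) → (Fin 4 × Fin 4 → K) → K := fun x y =>
    2 * ((x (2, 0) + x (2, 1) + x (2, 2) + x (2, 3)) * (y (3, 0) + y (3, 1) + y (3, 2) + y (3, 3)) +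
        (y (2, 0) + y (2, 1) + y (2, 2) + y (2, 3)) * (x (3, 0) + x (3, 1) + x (3, 2) + x (3, 3)) -
      (x (2, 0) * y (3, 0) + x (2, 1) * y (3, 1) + x (2, 2) * y (3, 2) + x (2, 3) * y (3, 3) +
        (y (2, 0) * x (3, 0) + y (2, 1) * x (3, 1) + y (2, 2) * x (3, 2) + y (2, 3) * x (3, 3))))
  have hB : ∀ x y, B x y =
    2 * ((x (2, 0) + x (2, 1) + x (2, 2) + x (2, 3)) * (y (3, 0) + y (3, 1) + y (3, 2) + y (3, 3)) +
        (y (2, 0) + y (2, 1) + y (2, 2) + y (2, 3)) * (x (3, 0) + x (3, 1) + x (3, 2) + x (3, 3)) -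
      (x (2, 0) * y (3, 0) + x (2, 1) * y (3, 1) + x (2, 2) * y (3, 2) + x (2, 3) * y (3, 3) +
        (y (2, 0) * x (3, 0) + y (2, 1) * x (3, 1) + y (2, 2) * x (3, 2) + y (2, 3) * x (3, 3)))) :=
    fun x y => rfl
  let β : (Fin 4 × Fin 4 → K) →ₗ[K] Module.Dual K (Fin 4 × Fin 4 → K) :=
    LinearMap.mk₂ K B
      (fun x₁ x₂ y => by simp only [hB, Pi.add_apply]; ring)
      (fun c x y => by simp only [hB, Pi.smul_apply, smul_eq_mul]; ring)
      (fun x y₁ y₂ => by simp only [hB, Pi.add_apply]; ring)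
      (fun c x y => by simp only [hB, Pi.smul_apply, smul_eq_mul]; ring)
  have hβ : ∀ x y, β x y = B x y := fun x y => rfl
  -- `B(x₀, y) = 0` for `x₀ ∈ N`, `y ∈ V` (polarise `hrad`, using `H x₀ = 0`)
  have hz : ∀ x₀ ∈ N,
      2 * ((x₀ (2, 0) + x₀ (2, 1) + x₀ (2, 2) + x₀ (2, 3)) *
          (x₀ (3, 0) + x₀ (3, 1) + x₀ (3, 2) + x₀ (3, 3)) -
        (x₀ (2, 0) * x₀ (3, 0) + x₀ (2, 1) * x₀ (3, 1) + x₀ (2, 2) * x₀ (3, 2) +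
          x₀ (2, 3) * x₀ (3, 3))) = 0 := fun x₀ hx₀ => by
    simpa using hrad x₀ hx₀ 0 V.zero_mem
  have hBV : ∀ x₀ ∈ N, ∀ y ∈ V, β x₀ y = 0 := by
    intro x₀ hx₀ y hy
    have h := hrad x₀ hx₀ y hy
    have h0 := hz x₀ hx₀
    simp only [Pi.add_apply] at h
    rw [hβ, hB]
    linear_combination h - h0
  -- `B(x, y) = 0` when rows `2, 3` of `y` vanish
  have hBW : ∀ x y : Fin 4 × Fin 4 → K, (∀ j, y (2, j) = 0) → (∀ j, y (3, j) = 0) → β x y = 0 := by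
    intro x y h2 h3
    rw [hβ, hB]
    simp [h2, h3]
  -- the complementary block `W'` (rows `2, 3` zero), `dim W' = 8`, `V ⊓ W' = 0`
  let ρ : Fin 4 → (Fin 4 × Fin 4 → K) →ₗ[K] (Fin 4 → K) :=
    fun r => LinearMap.funLeft K K fun j => (r, j)
  have hρ : ∀ r x j, ρ r x j = x (r, j) := fun _ _ _ => rfl
  let W' : Submodule K (Fin 4 × Fin 4 → K) := LinearMap.ker (ρ 2) ⊓ LinearMap.ker (ρ 3)
  have hW'mem : ∀ y ∈ W', (∀ j, y (2, j) = 0) ∧ ∀ j, y (3, j) = 0 := fun y hy => by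
    simp only [W', Submodule.mem_inf, LinearMap.mem_ker] at hy
    exact ⟨fun j => congr_fun hy.1 j, fun j => congr_fun hy.2 j⟩
  have hW' : finrank K W' = 8 := finrank_rowsZero 2 3 (by decide)
  have hcases : ∀ i : Fin 4, i = 0 ∨ i = 1 ∨ i = 2 ∨ i = 3 := by decide
  have hinf : V ⊓ W' = ⊥ := by
    rw [eq_bot_iff]
    intro y hy
    obtain ⟨hyV, hyW⟩ := Submodule.mem_inf.1 hy
    rw [Submodule.mem_bot]
    funext ⟨i, j⟩
    rw [Pi.zero_apply]
    rcases hcases i with rfl | rfl | rfl | rfl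
    · exact (hV y hyV j).1
    · exact (hV y hyV j).2
    · exact (hW'mem y hyW).1 j
    · exact (hW'mem y hyW).2 j
  have hsup : finrank K ↥(V ⊔ W') = finrank K V + 8 := by
    have h := Submodule.finrank_sup_add_finrank_inf_eq V W'
    rw [hinf, finrank_bot, hW'] at h
    omega
  -- the annihilator of `V ⊔ W'` has dimension `16 − (dim V + 8)`
  have hann : finrank K ↥(V ⊔ W') + finrank K ↥((V ⊔ W').dualAnnihilator) = 16 := by
    rw [Subspace.finrank_add_finrank_dualAnnihilator_eq, finrank_fintype_fun_eq_card,
      Fintype.card_prod, Fintype.card_fin]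
  -- `β` maps `N` injectively into that annihilator
  let g : ↥N →ₗ[K] Module.Dual K (Fin 4 × Fin 4 → K) := β.comp N.subtype
  have hrange : LinearMap.range g ≤ (V ⊔ W').dualAnnihilator := by
    rintro _ ⟨⟨x₀, hx₀⟩, rfl⟩
    rw [Submodule.mem_dualAnnihilator]
    intro w hw
    obtain ⟨y, hy, y', hy', rfl⟩ := Submodule.mem_sup.1 hw
    show β x₀ (y + y') = 0
    rw [map_add, hBV x₀ hx₀ y hy, hBW x₀ y' (hW'mem y' hy').1 (hW'mem y' hy').2, add_zero]
  have hker : LinearMap.ker g = ⊥ := by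
    rw [eq_bot_iff]
    rintro ⟨x₀, hx₀⟩ hg
    rw [LinearMap.mem_ker] at hg
    have hgx : ∀ y, β x₀ y = 0 := fun y => LinearMap.congr_fun hg y
    rw [Submodule.mem_bot, Subtype.ext_iff, Submodule.coe_mk, Submodule.coe_zero]
    have hx₀V : x₀ ∈ V := hNV hx₀
    -- test vectors `E_{3j}` (give row `2`) and `E_{2j}` (give row `3`)
    have t30 := hgx (Pi.single (3, 0) 1)
    have t31 := hgx (Pi.single (3, 1) 1)
    have t32 := hgx (Pi.single (3, 2) 1)
    have t33 := hgx (Pi.single (3, 3) 1)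
    have t20 := hgx (Pi.single (2, 0) 1)
    have t21 := hgx (Pi.single (2, 1) 1)
    have t22 := hgx (Pi.single (2, 2) 1)
    have t23 := hgx (Pi.single (2, 3) 1)
    simp only [hβ, hB, Pi.single_apply, Prod.mk.injEq,
      show ((2 : Fin 4) = 3) = False by decide, show ((3 : Fin 4) = 2) = False by decide,
      show ((0 : Fin 4) = 1) = False by decide, show ((0 : Fin 4) = 2) = False by decide,
      show ((0 : Fin 4) = 3) = False by decide, show ((1 : Fin 4) = 0) = False by decide,
      show ((1 : Fin 4) = 2) = False by decide, show ((1 : Fin 4) = 3) = False by decide,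
      show ((2 : Fin 4) = 0) = False by decide, show ((2 : Fin 4) = 1) = False by decide,
      show ((3 : Fin 4) = 0) = False by decide, show ((3 : Fin 4) = 1) = False by decide,
      and_true, and_false, if_true, if_false, add_zero, zero_add, mul_one,
      mul_zero, zero_mul] at t30 t31 t32 t33 t20 t21 t22 t23
    set a0 := x₀ (2, 0); set a1 := x₀ (2, 1); set a2 := x₀ (2, 2); set a3 := x₀ (2, 3)
    set b0 := x₀ (3, 0); set b1 := x₀ (3, 1); set b2 := x₀ (3, 2); set b3 := x₀ (3, 3)
    have hSa : a0 + a1 + a2 + a3 = 0 := by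
      have h6 : (6 : K) * (a0 + a1 + a2 + a3) = 0 := by linear_combination t30 + t31 + t32 + t33
      exact (mul_eq_zero.1 h6).resolve_left (by norm_num)
    have hSb : b0 + b1 + b2 + b3 = 0 := by
      have h6 : (6 : K) * (b0 + b1 + b2 + b3) = 0 := by linear_combination t20 + t21 + t22 + t23
      exact (mul_eq_zero.1 h6).resolve_left (by norm_num)
    have ha0 : a0 = 0 := (mul_eq_zero.1 (show (2 : K) * a0 = 0 by
      linear_combination 2 * hSa - t30)).resolve_left two_ne_zero
    have ha1 : a1 = 0 := (mul_eq_zero.1 (show (2 : K) * a1 = 0 by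
      linear_combination 2 * hSa - t31)).resolve_left two_ne_zero
    have ha2 : a2 = 0 := (mul_eq_zero.1 (show (2 : K) * a2 = 0 by
      linear_combination 2 * hSa - t32)).resolve_left two_ne_zero
    have ha3 : a3 = 0 := (mul_eq_zero.1 (show (2 : K) * a3 = 0 by
      linear_combination 2 * hSa - t33)).resolve_left two_ne_zero
    have hb0 : b0 = 0 := (mul_eq_zero.1 (show (2 : K) * b0 = 0 by
      linear_combination 2 * hSb - t20)).resolve_left two_ne_zero
    have hb1 : b1 = 0 := (mul_eq_zero.1 (show (2 : K) * b1 = 0 by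
      linear_combination 2 * hSb - t21)).resolve_left two_ne_zero
    have hb2 : b2 = 0 := (mul_eq_zero.1 (show (2 : K) * b2 = 0 by
      linear_combination 2 * hSb - t22)).resolve_left two_ne_zero
    have hb3 : b3 = 0 := (mul_eq_zero.1 (show (2 : K) * b3 = 0 by
      linear_combination 2 * hSb - t23)).resolve_left two_ne_zero
    funext ⟨i, j⟩
    rw [Pi.zero_apply]
    rcases hcases i with rfl | rfl | rfl | rfl
    · exact (hV x₀ hx₀V j).1
    · exact (hV x₀ hx₀V j).2
    · rcases hcases j with rfl | rfl | rfl | rfl <;> assumption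
    · rcases hcases j with rfl | rfl | rfl | rfl <;> assumption
  have hN : finrank K N = finrank K (LinearMap.range g) := by
    have h := g.finrank_range_add_finrank_ker
    rw [hker, finrank_bot, add_zero] at h
    exact h.symm
  have hle : finrank K (LinearMap.range g) ≤ finrank K ↥((V ⊔ W').dualAnnihilator) :=
    Submodule.finrank_mono hrange
  omega

/-- **Canonical position, one base point.**  `V` = matrices with rows `0, 1` zero; if at the base
point `u = 𝟙_{rows 0,1}` the `s²`-coefficient of `per_4 (u + s x)` along `V` is
`Σ_{k ∈ ι} c_k (Λ_k x)²`, then `2 dim V ≤ |ι| + 8`. [folklore] -/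
theorem two_mul_finrank_le_rows01 [CharZero K] {ι : Type*} [Fintype ι]
    (V : Submodule K (Fin 4 × Fin 4 → K)) (hV : ∀ x ∈ V, ∀ j, x (0, j) = 0 ∧ x (1, j) = 0)
    (c : ι → K) (Λ : ι → ((Fin 4 × Fin 4 → K) →ₗ[K] K))
    (he : ∀ x ∈ V, ∃ e₀ e₁ : K, ∀ s : K,
      eval ((fun p : Fin 4 × Fin 4 => if p.1 = 0 then (1 : K) else if p.1 = 1 then 1 else 0) + s • x)
        (perPoly (Fin 4) K) = e₀ + s * e₁ + s ^ 2 * ∑ k, c k * (Λ k x) ^ 2) :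
    2 * finrank K V ≤ Fintype.card ι + 8 := by
  -- `Σ_k c_k Λ_k(x)² = H(x)` on `V` (compare `s = 0, 1, -1`)
  have he₂ : ∀ x ∈ V, ∑ k, c k * (Λ k x) ^ 2 =
      2 * ((x (2, 0) + x (2, 1) + x (2, 2) + x (2, 3)) * (x (3, 0) + x (3, 1) + x (3, 2) + x (3, 3)) -
        (x (2, 0) * x (3, 0) + x (2, 1) * x (3, 1) + x (2, 2) * x (3, 2) + x (2, 3) * x (3, 3))) := by
    intro x hx
    obtain ⟨e₀, e₁, h⟩ := he x hx
    have P : ∀ s : K, e₀ + s * e₁ + s ^ 2 * ∑ k, c k * (Λ k x) ^ 2 = s ^ 2 *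
        (2 * ((x (2, 0) + x (2, 1) + x (2, 2) + x (2, 3)) * (x (3, 0) + x (3, 1) + x (3, 2) + x (3, 3)) -
          (x (2, 0) * x (3, 0) + x (2, 1) * x (3, 1) + x (2, 2) * x (3, 2) + x (2, 3) * x (3, 3)))) :=
      fun s => by
      rw [← h s, eval_perPoly_ones01_add_smul x (fun j => (hV x hx j).1) (fun j => (hV x hx j).2)]
    have h0 := P 0; have h1 := P 1; have h1' := P (-1)
    have h2 : (2 : K) * ∑ k, c k * (Λ k x) ^ 2 = 2 *
        (2 * ((x (2, 0) + x (2, 1) + x (2, 2) + x (2, 3)) * (x (3, 0) + x (3, 1) + x (3, 2) + x (3, 3)) -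
          (x (2, 0) * x (3, 0) + x (2, 1) * x (3, 1) + x (2, 2) * x (3, 2) + x (2, 3) * x (3, 3)))) := by
      linear_combination h1 + h1' - 2 * h0
    exact (mul_right_inj' two_ne_zero).1 h2
  obtain ⟨N, hNV, hdim, hN⟩ := exists_commonKernel V Λ
  have hrad : ∀ x₀ ∈ N, ∀ y ∈ V,
      2 * (((x₀ + y) (2, 0) + (x₀ + y) (2, 1) + (x₀ + y) (2, 2) + (x₀ + y) (2, 3)) *
            ((x₀ + y) (3, 0) + (x₀ + y) (3, 1) + (x₀ + y) (3, 2) + (x₀ + y) (3, 3)) -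
          ((x₀ + y) (2, 0) * (x₀ + y) (3, 0) + (x₀ + y) (2, 1) * (x₀ + y) (3, 1) +
            (x₀ + y) (2, 2) * (x₀ + y) (3, 2) + (x₀ + y) (2, 3) * (x₀ + y) (3, 3))) =
      2 * ((y (2, 0) + y (2, 1) + y (2, 2) + y (2, 3)) * (y (3, 0) + y (3, 1) + y (3, 2) + y (3, 3)) -
          (y (2, 0) * y (3, 0) + y (2, 1) * y (3, 1) + y (2, 2) * y (3, 2) + y (2, 3) * y (3, 3))) := by
    intro x₀ hx₀ y hy
    rw [← he₂ y hy, ← he₂ (x₀ + y) (V.add_mem (hNV hx₀) hy)]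
    refine Finset.sum_congr rfl fun k _ => ?_
    rw [map_add, hN x₀ hx₀ k, zero_add]
  have h8 := finrank_add_finrank_le_eight_rows01 V N hV hNV hrad
  omega

/-- **Transport of a family of `|ι|`-square expansions along a `per_4`-preserving linear
automorphism** (row/column permutations, transposition). [folklore] -/
theorem sqFamily_map {ι : Type*} [Fintype ι] (V : Submodule K (Fin 4 × Fin 4 → K))
    (Φ : (Fin 4 × Fin 4 → K) ≃ₗ[K] (Fin 4 × Fin 4 → K))
    (hΦ : ∀ z, eval (Φ z) (perPoly (Fin 4) K) = eval z (perPoly (Fin 4) K))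
    (hform : ∀ u : Fin 4 × Fin 4 → K, ∃ (c : ι → K) (Λ : ι → ((Fin 4 × Fin 4 → K) →ₗ[K] K)),
      ∀ x ∈ V, ∃ e₀ e₁ : K, ∀ s : K,
        eval (u + s • x) (perPoly (Fin 4) K) = e₀ + s * e₁ + s ^ 2 * ∑ k, c k * (Λ k x) ^ 2) :
    ∀ u : Fin 4 × Fin 4 → K, ∃ (c : ι → K) (Λ : ι → ((Fin 4 × Fin 4 → K) →ₗ[K] K)),
      ∀ y ∈ V.map Φ.toLinearMap, ∃ e₀ e₁ : K, ∀ s : K,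
        eval (u + s • y) (perPoly (Fin 4) K) = e₀ + s * e₁ + s ^ 2 * ∑ k, c k * (Λ k y) ^ 2 := by
  intro u
  obtain ⟨c, Λ, he⟩ := hform (Φ.symm u)
  refine ⟨c, fun k => (Λ k).comp Φ.symm.toLinearMap, ?_⟩
  rintro _ ⟨x, hx, rfl⟩
  obtain ⟨e₀, e₁, h⟩ := he x hx
  refine ⟨e₀, e₁, fun s => ?_⟩
  have hu : u + s • Φ.toLinearMap x = Φ (Φ.symm u + s • x) := by
    rw [map_add, map_smul, LinearEquiv.apply_symm_apply]; rfl
  rw [hu, hΦ, h s]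
  refine congrArg (fun t => e₀ + s * e₁ + s ^ 2 * t) (Finset.sum_congr rfl fun k _ => ?_)
  rw [LinearMap.comp_apply, LinearEquiv.coe_toLinearMap, LinearEquiv.coe_toLinearMap,
    LinearEquiv.symm_apply_apply]

/-- **Two prescribed zero rows.**  If `V` (rows `a ≠ b` zero) carries, for every base point `u`,
an expansion of the `s²`-coefficient of `per_4 (u + s y)` as `|ι|` weighted squares of linear
forms, then `2 dim V ≤ |ι| + 8`. [folklore] -/
theorem two_mul_finrank_le_of_sq_family_rows [CharZero K] {ι : Type*} [Fintype ι]
    (V : Submodule K (Fin 4 × Fin 4 → K)) {a b : Fin 4} (hab : a ≠ b)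
    (hV : ∀ x ∈ V, ∀ j, x (a, j) = 0 ∧ x (b, j) = 0)
    (hform : ∀ u : Fin 4 × Fin 4 → K, ∃ (c : ι → K) (Λ : ι → ((Fin 4 × Fin 4 → K) →ₗ[K] K)),
      ∀ y ∈ V, ∃ e₀ e₁ : K, ∀ s : K,
        eval (u + s • y) (perPoly (Fin 4) K) = e₀ + s * e₁ + s ^ 2 * ∑ k, c k * (Λ k y) ^ 2) :
    2 * finrank K V ≤ Fintype.card ι + 8 := by
  obtain ⟨σ, hσ0, hσ1⟩ := exists_perm_zero_one a b hab
  set e := Equiv.prodCongr σ (1 : Equiv.Perm (Fin 4)) with he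
  set Φ : (Fin 4 × Fin 4 → K) ≃ₗ[K] (Fin 4 × Fin 4 → K) := LinearEquiv.funCongrLeft K K e with hΦ
  have hΦa : ∀ (x : Fin 4 × Fin 4 → K) (i j : Fin 4), Φ x (i, j) = x (σ i, j) := fun x i j => by
    simp [hΦ, he]
  have hΦper : ∀ z, eval (Φ z) (perPoly (Fin 4) K) = eval z (perPoly (Fin 4) K) := fun z => by
    have : (Φ z : Fin 4 × Fin 4 → K) = z ∘ e := rfl
    rw [this, he, eval_perPoly_comp_prodCongr]
  have hform' := sqFamily_map V Φ hΦper hform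
  set V' := V.map Φ.toLinearMap with hV'def
  have hfin : finrank K V' = finrank K V := by rw [hV'def, LinearEquiv.finrank_map_eq]
  have hV' : ∀ y ∈ V', ∀ j, y (0, j) = 0 ∧ y (1, j) = 0 := by
    rintro _ ⟨x, hx, rfl⟩ j
    rw [LinearEquiv.coe_toLinearMap, hΦa, hΦa, hσ0, hσ1]
    exact hV x hx j
  obtain ⟨c, Λ, he'⟩ :=
    hform' (fun p : Fin 4 × Fin 4 => if p.1 = 0 then (1 : K) else if p.1 = 1 then 1 else 0)
  have h := two_mul_finrank_le_rows01 V' hV' c Λ he'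
  omega

/-- **Two prescribed zero rows or two prescribed zero columns** (the shape produced by
`SymPencilBoxFourEquality.two_rows_or_two_cols` at `dim V = 8`, and by restriction for smaller
kernels inside a block): a family of `|ι|`-square expansions of the `s²`-coefficient forces
`2 dim V ≤ |ι| + 8`.  (`dim V = 8`: `|ι| ≥ 8`; `dim V = 7`: `|ι| ≥ 6`; `dim V = 6`: `|ι| ≥ 4`;
`dim V = 5`: `|ι| ≥ 2`.) [folklore] -/
theorem two_mul_finrank_le_card_add_eight_of_sq_family [CharZero K] {ι : Type*} [Fintype ι]
    (V : Submodule K (Fin 4 × Fin 4 → K))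
    (hV : (∃ a b : Fin 4, a ≠ b ∧ ∀ x ∈ V, ∀ j, x (a, j) = 0 ∧ x (b, j) = 0) ∨
      (∃ a b : Fin 4, a ≠ b ∧ ∀ x ∈ V, ∀ i, x (i, a) = 0 ∧ x (i, b) = 0))
    (hform : ∀ u : Fin 4 × Fin 4 → K, ∃ (c : ι → K) (Λ : ι → ((Fin 4 × Fin 4 → K) →ₗ[K] K)),
      ∀ y ∈ V, ∃ e₀ e₁ : K, ∀ s : K,
        eval (u + s • y) (perPoly (Fin 4) K) = e₀ + s * e₁ + s ^ 2 * ∑ k, c k * (Λ k y) ^ 2) :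
    2 * finrank K V ≤ Fintype.card ι + 8 := by
  rcases hV with ⟨a, b, hab, hV⟩ | ⟨a, b, hab, hV⟩
  · exact two_mul_finrank_le_of_sq_family_rows V hab hV hform
  · -- transpose, then the row case
    set Φ : (Fin 4 × Fin 4 → K) ≃ₗ[K] (Fin 4 × Fin 4 → K) :=
      LinearEquiv.funCongrLeft K K (Equiv.prodComm (Fin 4) (Fin 4)) with hΦ
    have hΦa : ∀ (x : Fin 4 × Fin 4 → K) (i j : Fin 4), Φ x (i, j) = x (j, i) := fun x i j => rfl
    have hform' := sqFamily_map V Φ eval_perPoly_transpose hform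
    set V' := V.map Φ.toLinearMap with hV'def
    have hfin : finrank K V' = finrank K V := by rw [hV'def, LinearEquiv.finrank_map_eq]
    have hV' : ∀ y ∈ V', ∀ j, y (a, j) = 0 ∧ y (b, j) = 0 := by
      rintro _ ⟨x, hx, rfl⟩ j
      rw [LinearEquiv.coe_toLinearMap, hΦa, hΦa]
      exact hV x hx j
    have h := two_mul_finrank_le_of_sq_family_rows V' hab hV' hform'
    omega

/-- **Negative form** (how the pencil argument consumes it): inside a two-row or two-column block,
a `d`-dimensional kernel with `|ι| + 8 < 2 d` admits no family of `|ι|`-square expansions of the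
`s²`-coefficient over all base points. [folklore] -/
theorem not_sq_family_of_card_add_eight_lt [CharZero K] {ι : Type*} [Fintype ι]
    (V : Submodule K (Fin 4 × Fin 4 → K))
    (hV : (∃ a b : Fin 4, a ≠ b ∧ ∀ x ∈ V, ∀ j, x (a, j) = 0 ∧ x (b, j) = 0) ∨
      (∃ a b : Fin 4, a ≠ b ∧ ∀ x ∈ V, ∀ i, x (i, a) = 0 ∧ x (i, b) = 0))
    (hlt : Fintype.card ι + 8 < 2 * finrank K V) :
    ¬ (∀ u : Fin 4 × Fin 4 → K, ∃ (c : ι → K) (Λ : ι → ((Fin 4 × Fin 4 → K) →ₗ[K] K)),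
        ∀ y ∈ V, ∃ e₀ e₁ : K, ∀ s : K,
          eval (u + s • y) (perPoly (Fin 4) K) =
            e₀ + s * e₁ + s ^ 2 * ∑ k, c k * (Λ k y) ^ 2) := fun hform =>
  absurd (two_mul_finrank_le_card_add_eight_of_sq_family V hV hform) (not_le.2 hlt)

end Summit.ValiantsHypothesis.ValiantsHypothesis.Theorems.SymPencilPerFourCoordinateRadical

end
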